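import Mathlib.Analysis.Calculus.Deriv.Inverse
import Mathlib.Analysis.Calculus.Deriv.MeanValue
import Mathlib.Analysis.Calculus.ContDiff.Deriv
import Mathlib.Analysis.Calculus.ContDiff.Operations
import Mathlib.Topology.Order.MonotoneContinuity
import Mathlib.Topology.Order.IntermediateValue
import HarnessLib

/-!
# The smooth inverse of a function on `ℝ` with positive derivative
(topic `Literature/Analysis/Calculus`; namespace `Literature.Analysis.Calculus`; proved, no named fact)

If `f : ℝ → ℝ` has a derivative `f' > 0` everywhere then `f` is a strictly increasing
diffeomorphism of `ℝ` onto the open interval `R = range f`, and its inverse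
`σ = Function.invFun f` (Mathlib's choice of a preimage, arbitrary off the range) is as smooth as
`f` on `R`, with `σ' = 1/(f' ∘ σ)`. This is the reparametrisation of a future-directed causal curve
`γ` by a time function `t = γ⁰(s)` (`ṫ > 0`) used to read a geodesic as a graph over the time axis,
`X(t) = γ(σ(t)) = (t, c(t))` (e.g. Sbierski, Anal. PDE 8 (2015), §4: the foliation `Σ_τ` meets the
null geodesic in single points `γ_τ`; the Gaussian-beam construction of
`Literature/Geometry/Lorentzian/GaussianBeam*.lean` is carried out in that parametrisation).

All statements are about `Function.invFun f` (`Function.invFun_eq : f (invFun f t) = t` on the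
range, `Function.leftInverse_invFun : invFun f (f s) = s` for injective `f`):

* `strictMono`, `strictMonoOn_invFun`;
* `isOpen_range` — the range is open (IVT); `continuousAt_invFun`, `hasDerivAt_invFun`
  (`σ' = (f'(σ))⁻¹`), `differentiableOn_invFun`;
* `contDiffOn_of_hasDerivAt_comp` — the `C^∞` bootstrap for `Z' = F(Z)` on an open set;
  `contDiffOn_invFun` — `σ ∈ C^∞(R)` if `f ∈ C^∞` with `f' > 0`.

## References

* Folklore (the inverse function theorem in one variable); cf. B. O'Neill, *Semi-Riemannian
  geometry*, 1983, Ch. 1 (diffeomorphisms), and J. Sbierski, Anal. PDE 8 (2015), §4 for the use.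
-/

noncomputable section

open Set Filter Topology Function
open scoped ContDiff

namespace Literature.Analysis.Calculus

namespace StrictMonoInverse

variable {f f' : ℝ → ℝ} (hf : ∀ s, HasDerivAt f (f' s) s) (hpos : ∀ s, 0 < f' s)
include hf hpos

/-- `f` is strictly increasing. [folklore] -/
theorem strictMono : StrictMono f := strictMono_of_hasDerivAt_pos hf hpos

/-- `σ (f s) = s` for `σ = invFun f`. [folklore] -/
theorem invFun_apply (s : ℝ) : invFun f (f s) = s :=
  leftInverse_invFun (strictMono hf hpos).injective s

/-- `σ` is strictly increasing on the range. [folklore] -/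
theorem strictMonoOn_invFun : StrictMonoOn (invFun f) (range f) := by
  intro t ht t' ht' hlt
  by_contra h
  push Not at h
  have := (strictMono hf hpos).monotone h
  rw [invFun_eq ht, invFun_eq ht'] at this
  exact absurd hlt (not_lt.2 this)

/-- **The range is open**: around `f s` it contains `(f(s − 1), f(s + 1))` by the intermediate
value theorem. [folklore] -/
theorem isOpen_range : IsOpen (range f) := by
  have hcont : Continuous f := continuous_iff_continuousAt.2 fun s ↦ (hf s).continuousAt
  rw [isOpen_iff_mem_nhds]
  rintro _ ⟨s, rfl⟩
  have hlt1 : f (s - 1) < f s := strictMono hf hpos (by linarith)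
  have hlt2 : f s < f (s + 1) := strictMono hf hpos (by linarith)
  have hsub : Ioo (f (s - 1)) (f (s + 1)) ⊆ range f := by
    intro t ht
    obtain ⟨r, -, hr⟩ := intermediate_value_Ioo (show s - 1 ≤ s + 1 by linarith)
      hcont.continuousOn ht
    exact ⟨r, hr⟩
  exact mem_of_superset (Ioo_mem_nhds hlt1 hlt2) hsub

/-- `σ` is continuous at the points of the range. [folklore] -/
theorem continuousAt_invFun {t : ℝ} (ht : t ∈ range f) : ContinuousAt (invFun f) t := by
  refine continuousAt_of_monotoneOn_of_image_mem_nhds (strictMonoOn_invFun hf hpos).monotoneOn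
    ((isOpen_range hf hpos).mem_nhds ht) ?_
  have himage : invFun f '' range f = univ :=
    eq_univ_of_forall fun s ↦ ⟨f s, mem_range_self s, invFun_apply hf hpos s⟩
  rw [himage]
  exact univ_mem

/-- **`σ' = (f'(σ))⁻¹`** on the range. [folklore] -/
theorem hasDerivAt_invFun {t : ℝ} (ht : t ∈ range f) :
    HasDerivAt (invFun f) (f' (invFun f t))⁻¹ t := by
  refine (hf (invFun f t)).of_local_left_inverse (continuousAt_invFun hf hpos ht) (hpos _).ne' ?_
  filter_upwards [(isOpen_range hf hpos).mem_nhds ht] with t' ht' using invFun_eq ht'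

/-- `σ` is differentiable on the range. [folklore] -/
theorem differentiableOn_invFun : DifferentiableOn ℝ (invFun f) (range f) := fun _ ht ↦
  (hasDerivAt_invFun hf hpos ht).differentiableAt.differentiableWithinAt

omit hf hpos in
/-- **Regularity bootstrap on an open set**: a function `Z` with `Z' = F(Z)` on an open set `R`,
`F` of class `C^k` at the points `Z t` for every `k`, is `C^∞` on `R`. [folklore] -/
theorem contDiffOn_of_hasDerivAt_comp {Z F : ℝ → ℝ} {R : Set ℝ} (hR : IsOpen R)
    (hZ : ∀ t ∈ R, HasDerivAt Z (F (Z t)) t) (hF : ∀ (k : ℕ), ∀ t ∈ R, ContDiffAt ℝ k F (Z t)) :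
    ContDiffOn ℝ ∞ Z R := by
  have hd : ∀ t ∈ R, deriv Z t = F (Z t) := fun t ht ↦ (hZ t ht).deriv
  have key : ∀ k : ℕ, ContDiffOn ℝ k Z R := by
    intro k
    induction k with
    | zero =>
        rw [Nat.cast_zero]
        exact contDiffOn_zero.2 (continuousOn_of_forall_continuousAt fun t ht ↦ (hZ t ht).continuousAt)
    | succ k ih =>
        rw [Nat.cast_succ, contDiffOn_succ_iff_deriv_of_isOpen hR]
        refine ⟨fun t ht ↦ (hZ t ht).differentiableAt.differentiableWithinAt,
          fun h ↦ absurd h (WithTop.natCast_ne_top k), ?_⟩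
        have hcomp : ContDiffOn ℝ k (fun t ↦ F (Z t)) R := fun t ht ↦
          (hF k t ht).comp_contDiffWithinAt t (ih t ht)
        exact hcomp.congr fun t ht ↦ hd t ht
  exact contDiffOn_infty.2 key

omit hf hpos in
/-- **The inverse is `C^∞` on the range** when `f ∈ C^∞` with positive derivative.
[folklore] -/
theorem contDiffOn_invFun (hfc : ContDiff ℝ ∞ f) (hpos' : ∀ s, 0 < deriv f s) :
    ContDiffOn ℝ ∞ (invFun f) (range f) := by
  have hf' : ∀ s, HasDerivAt f (deriv f s) s := fun s ↦
    (hfc.differentiable (by simp) s).hasDerivAt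
  have hderiv : ContDiff ℝ ∞ (deriv f) := hfc.deriv'
  refine contDiffOn_of_hasDerivAt_comp (F := fun z ↦ (deriv f z)⁻¹) (isOpen_range hf' hpos')
    (fun t ht ↦ hasDerivAt_invFun hf' hpos' ht) fun k _ _ ↦ ?_
  exact (hderiv.of_le (by exact_mod_cast le_top)).contDiffAt.inv (hpos' _).ne'

end StrictMonoInverse

end Literature.Analysis.Calculus
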